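import Literature.NumberTheory.GaloisCohomology.Howard2004.RelaxedSelmerLagrangianCountProofs
import Literature.NumberTheory.GaloisCohomology.Howard2004.FrobeniusReadoutSelfAnnihilatorProofs
import HarnessLib

/-!
# Howard 2004, Lemma 1.5.6 at an inert prime, the count `#A · #A = #H¹(K_q, T)` — FROBENIUS form
# (H²-detection as a binder, valid for NON-FREE level rings; proofs file)

Topic `NumberTheory/GaloisCohomology/Howard2004`. THEOREMS ONLY: no definition, no named fact, no instance, no
notation, no `sorry`. Cell `pub/bsd-print-x9`, print leaf G87 `thm161_dvrKolyvaginBound` (Howard Thm. 1.6.1); seat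
`bsd-line-x9-p1-w4` g16, brick (READ-REBASE) part 3 = the TWIN of `RelaxedSelmerLagrangianCountProofs` §3–§4 (same seat,
brick (A-PERP-COUNT)) with the dualizing-family binder `hbij` replaced by the H²-detection binder

  `hdet : ∀ v (z : H²(K_v, R(1))), (∀ b : R, H²(exp ∘ λ_b) z = 0) → z = 0`

(x10b-p1-w6 g9 «READ-NONFREE», bsd-line-x10b-p1 LEAD g12 ruling 2026-08-29: at the refined levels `R/π^e` of a
ramified DVR `(R, +)` is not free over `ℤ/p^k`, so no dualizing family exists, but the H²-detection holds — (READ-H2)),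
and the stability binder `hstab` quantified over all scalars `b ∈ R`.  §1–§2 of the original (`T_q` is `R`-linear and
bijective, (hnd)) are hbij-free and imported, not restated.  Here:

* §3 **`forall_reading_eq_zero_iff_mem_map_localization_frob`**: the `ℤ/p^k`-reading annihilator of
  `X = transport_q(loc_{σq} H¹_𝓡(K, T))` is `A = loc_q H¹_𝓡(K, T)`;
* §4 **`natCard_map_localization_selmerGroup_mul_self_frob`**: `#A · #A = #H¹(K_q, T)` («`len(A) = len(A^⟂)`»).

SOURCE. B. Howard, *The Heegner point Kolyvagin system*, Compositio Math. **140** (2004) = arXiv:1202.6340, Lemma 1.5.6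
(arXiv Lemma 2.5.6, p. 10 L80–97: «The sum of the lengths of `A` and `A^⟂` must be `4k·ν(m)` and we conclude that
`len(A) = len(A^⟂)` and so `A = A^⟂`»).
NOT HERE: `hdet` ((READ-H2)), the Frobenius character ((FROB-CHAR)), lengths over `R`; `thm161_dvrKolyvaginBound` is NOT
proved; no summit statement is proved; the Birch–Swinnerton-Dyer conjecture is not proved by any of this.
References: [Howard2004HeegnerKolyvagin] Lemma 1.5.6, Lemma 1.5.7, §1.3 H.4; [MilneADT2006] I Prop. 0.19, I Cor. 2.3;
[SerreGaloisCohomology1997] I §2.2–2.4, §5.1.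
-/

set_option autoImplicit false

noncomputable section

open Function NumberField IsDedekindDomain Field CategoryTheory
open scoped NumberField

namespace Literature.NumberTheory.GaloisCohomology.Howard2004

open Literature.NumberTheory.GaloisRepresentations
open Literature.NumberTheory.GaloisRepresentations.DiscreteGaloisModule
open Literature.NumberTheory.EllipticCurves

variable {K : Type} [Field K] [NumberField K] {M : Type} [AddCommGroup M] [TopologicalSpace M]
  [DiscreteTopology M] {R : Type} [CommRing R] [Module R M]

namespace DualityDatum

variable [TopologicalSpace R] [DiscreteTopology R]
  {p : ℕ} [Fact p.Prime] [Algebra ℤ_[p] R] {cd : ConjugationDatum K} {ρ : DiscreteGaloisModule K M}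
  [Finite M] (D : DualityDatum p cd ρ R) {k : ℕ}
  (lam : R →+ ZMod (p ^ k))
  (hlam : ∀ (z : ℤ_[p]) (r : R), lam (algebraMap ℤ_[p] R z * r) = PadicInt.toZModPow k z * lam r)
  (exp : ZMod (p ^ k) →+ MuCarrier K (p ^ k))
  (hexp : ∀ (g : absoluteGaloisGroup K) (x : ZMod (p ^ k)),
    exp (cyclotomicCharacterModPow K p k g * x) = mu K (p ^ k) g (exp x))

/-! ## §3 The reading annihilator of `transport_q(loc_{σq} H¹_𝓡)` is `A = loc_q H¹_𝓡` -/

/-- **The `ℤ/p^k`-reading annihilator of `X = transport_q(loc_{σq} H¹_𝓡(K, T))` in `H¹(K_q, T)` is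
`A = loc_q H¹_𝓡(K, T)`**: for `x ∈ H¹(K_q, T)`, `inv_q H²(exp ∘ λ)(x ∪_e y) = 0` for all `y ∈ X` iff `x ∈ A` — «⇐» is
«`A ⊆ A^⟂`», «⇒» reads the vanishing for `b • d`, `b ∈ R` (the Selmer group is `R`-stable and transport/localization commute
with the scalars) through `H²(exp ∘ λ_b)(x ∪ t) = H²(exp ∘ λ)(x ∪ b • t)` and the H²-detection `hdet`, and applies
«`A^⟂ ⊆ A`» (`FrobeniusReadoutSelfAnnihilatorProofs`).
[cite: Howard2004HeegnerKolyvagin, Lemma 1.5.6 (arXiv:1202.6340 Lemma 2.5.6, p. 10 L80–97)] [cite: MilneADT2006, Ch. I Cor. 2.3] -/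
theorem forall_reading_eq_zero_iff_mem_map_localization_frob
    (hn : ∀ m : M, (p ^ k) • m = 0) (hρ : ρ.IsScalarLinear R)
    (inv : LocalInvariants K (p ^ k)) (hPT : inv.SumLocalTermEqZero) (hSC : inv.SelmerComplement)
    (hperf : inv.IsPerfect) (hΘ : Bijective (D.toTateDual lam hlam exp hexp))
    (hdet : ∀ (v : Place K) (z : galoisCohomology (D.twistOne.toLocal v) 2),
      (∀ b : R, cohomologyMap (D.expLamLocalHom (lamMul lam b) (lamMul_semilinear lam hlam b) exp hexp v) 2 z = 0) →
        z = 0)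
    (S : Finset (Place K))
    (hS : ∀ v : HeightOneSpectrum (𝓞 K), (Sum.inr v : Place K) ∉ S →
      ((p ^ k : ℕ) : 𝓞 K) ∉ v.asIdeal ∧ GaloisRep.IsUnramifiedAt v ρ)
    (𝓕 𝓡 : SelmerStructure ρ) {q : HeightOneSpectrum (𝓞 K)} (hq : cd.σ • q = q)
    (hqS : (Sum.inr q : Place K) ∈ S) (h𝓡S : 𝓡.IsUnramifiedOutside S)
    (hrel : 𝓡 (Sum.inr q) = ⊤)
    (hoff : ∀ v : HeightOneSpectrum (𝓞 K), v ≠ q → 𝓡 (Sum.inr v) = 𝓕 (Sum.inr v))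
    (horth : ∀ v : HeightOneSpectrum (𝓞 K), v ≠ q → D.IsSelfOrthogonalAt 𝓕 v)
    (hstab : ∀ v : HeightOneSpectrum (𝓞 K), v ≠ q → ∀ b : R, ∀ a ∈ 𝓕 (Sum.inr v),
      galoisCohomology.scalarMapH1 (ρ.toLocal (Sum.inr v)) (isScalarLinear_toLocal hρ (Sum.inr v)) b a ∈
        𝓕 (Sum.inr v))
    (hinf : ∀ (w : InfinitePlace K) (c : galoisCohomology ρ 1),
      galoisCohomology.localization ρ (Sum.inl w) 1 c = 0)
    (x : galoisCohomology (ρ.toLocal (Sum.inr q)) 1) :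
    (∀ y ∈ (𝓡.selmerGroup.map (galoisCohomology.localization ρ (Sum.inr (cd.σ • q)) 1)).map (cd.transportH1 ρ q),
        inv (Sum.inr q) (cohomologyMap (D.expLamLocalHom lam hlam exp hexp (Sum.inr q)) 2
          (D.localCup (Sum.inr q) x y)) = 0) ↔
      x ∈ 𝓡.selmerGroup.map (galoisCohomology.localization ρ (Sum.inr q) 1) := by
  rw [D.mem_map_localization_selmerGroup_iff_forall_localCup_eq_zero_frob lam hlam exp hexp hn hρ inv hPT hSC
    (fun v => (hperf v).1.1) hΘ hdet S hS 𝓕 𝓡 hq hqS h𝓡S hrel hoff horth hstab hinf x]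
  constructor
  · intro h d hd
    -- read the vanishing for `b • d` through `λ_b` and detect
    refine hdet (Sum.inr q) _ fun b => ?_
    rw [D.cohomologyMap_expLam_lamMul_localCup lam hlam exp hexp hρ (Sum.inr q) b,
      ← cd.transportH1_scalarMapH1 ρ hρ q b,
      ← galoisCohomology.localization_scalarMapH1 hρ (Sum.inr (cd.σ • q)) b d]
    refine (hperf q).1.1 ((h _ ⟨_, ⟨_, scalarMapH1_mem_selmerGroup_of_eq_off hρ 𝓕 𝓡 hrel hoff b
      (fun v hv => hstab v hv b) hinf hd, rfl⟩, rfl⟩).trans (map_zero _).symm)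
  · rintro h y ⟨z, ⟨d, hd, rfl⟩, rfl⟩
    rw [h d hd]
    exact (congrArg (inv (Sum.inr q)) (map_zero _)).trans (map_zero _)

/-! ## §4 The count `#A · #A = #H¹(K_q, T)` -/

/-- **Howard 2004, Lemma 1.5.6, the count: `#A · #A = #H¹(K_q, T)` for `A = loc_q H¹_𝓡(K, T)`** at an inert prime
`q` (the structure `𝓡` relaxed at `q`, self-orthogonal and `R`-stable off `q`; hypotheses of
`mem_map_localization_selmerGroup_iff_forall_localCup_eq_zero_frob` with `IsPerfect`; Frobenius form: H²-detection `hdet` as a binder).  «The sum of the lengths of `A` and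
`A^⟂` must be `4k·ν(m)` … `len(A) = len(A^⟂)`»: here from `A = A^⟂` and `#A^⟂ · #X = #H¹(K_q, Tw T)` for the perfect
`ℤ/p^k`-reading of `∪_e` (Milne I Prop. 0.19 / Cor. 2.3), `#X = #A`, `#H¹(K_q, Tw T) = #H¹(K_q, T)`.
[cite: Howard2004HeegnerKolyvagin, Lemma 1.5.6 (arXiv:1202.6340 Lemma 2.5.6, p. 10 L93–97)] [cite: MilneADT2006, Ch. I Prop. 0.19 and Cor. 2.3] -/
theorem natCard_map_localization_selmerGroup_mul_self_frob
    (hn : ∀ m : M, (p ^ k) • m = 0) (hρ : ρ.IsScalarLinear R)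
    (inv : LocalInvariants K (p ^ k)) (hPT : inv.SumLocalTermEqZero) (hSC : inv.SelmerComplement)
    (hperf : inv.IsPerfect) (hΘ : Bijective (D.toTateDual lam hlam exp hexp))
    (hdet : ∀ (v : Place K) (z : galoisCohomology (D.twistOne.toLocal v) 2),
      (∀ b : R, cohomologyMap (D.expLamLocalHom (lamMul lam b) (lamMul_semilinear lam hlam b) exp hexp v) 2 z = 0) →
        z = 0)
    (S : Finset (Place K))
    (hS : ∀ v : HeightOneSpectrum (𝓞 K), (Sum.inr v : Place K) ∉ S →
      ((p ^ k : ℕ) : 𝓞 K) ∉ v.asIdeal ∧ GaloisRep.IsUnramifiedAt v ρ)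
    (𝓕 𝓡 : SelmerStructure ρ) {q : HeightOneSpectrum (𝓞 K)} (hq : cd.σ • q = q)
    (hqS : (Sum.inr q : Place K) ∈ S) (h𝓡S : 𝓡.IsUnramifiedOutside S)
    (hrel : 𝓡 (Sum.inr q) = ⊤)
    (hoff : ∀ v : HeightOneSpectrum (𝓞 K), v ≠ q → 𝓡 (Sum.inr v) = 𝓕 (Sum.inr v))
    (horth : ∀ v : HeightOneSpectrum (𝓞 K), v ≠ q → D.IsSelfOrthogonalAt 𝓕 v)
    (hstab : ∀ v : HeightOneSpectrum (𝓞 K), v ≠ q → ∀ b : R, ∀ a ∈ 𝓕 (Sum.inr v),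
      galoisCohomology.scalarMapH1 (ρ.toLocal (Sum.inr v)) (isScalarLinear_toLocal hρ (Sum.inr v)) b a ∈
        𝓕 (Sum.inr v))
    (hinf : ∀ (w : InfinitePlace K) (c : galoisCohomology ρ 1),
      galoisCohomology.localization ρ (Sum.inl w) 1 c = 0) :
    Nat.card (𝓡.selmerGroup.map (galoisCohomology.localization ρ (Sum.inr q) 1)) *
        Nat.card (𝓡.selmerGroup.map (galoisCohomology.localization ρ (Sum.inr q) 1)) =
      Nat.card (galoisCohomology (ρ.toLocal (Sum.inr q)) 1) := by
  haveI : NeZero (p ^ k) := ⟨pow_ne_zero k (Fact.out : p.Prime).ne_zero⟩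
  haveI := finite_galoisCohomology_one_toLocal ρ q
  haveI := finite_galoisCohomology_one_toLocal (cd.twist ρ) q
  -- the perfect reading pairing `b(x, y) = inv_q H²(exp ∘ λ)(x ∪_e y)`
  obtain ⟨b, hb_def⟩ : ∃ b : galoisCohomology (ρ.toLocal (Sum.inr q)) 1 →+
      galoisCohomology ((cd.twist ρ).toLocal (Sum.inr q)) 1 →+ ZMod (p ^ k),
      b = (localTatePairingZMod ρ (p ^ k) (Sum.inr q) (inv (Sum.inr q))).compl₂
        (galoisCohomology.map (EllipticCurves.DiscreteGaloisModule.localMap (D.toTateDual lam hlam exp hexp)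
          (Sum.inr q)) 1) := ⟨_, rfl⟩
  have hb_apply : ∀ x y, b x y = inv (Sum.inr q) (cohomologyMap (D.expLamLocalHom lam hlam exp hexp (Sum.inr q)) 2
      (D.localCup (Sum.inr q) x y)) := fun x y => by
    rw [hb_def, AddMonoidHom.compl₂_apply, localTatePairingZMod_apply,
      D.cohomologyMap_localCup_eq_localTatePairing lam hlam exp hexp]
  have hb : Bijective b := by
    refine ⟨?_, fun χ => ?_⟩
    · rw [hb_def]
      exact D.injective_localCupZMod lam hlam exp hexp hΘ (Sum.inr q) (inv (Sum.inr q)) ((hperf q).2 ρ hn).1.1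
    · obtain ⟨x, hx⟩ := D.exists_forall_reading_localCup_eq_flip lam hlam exp hexp hn hΘ q (inv (Sum.inr q))
        ((hperf q).2 ρ hn).1.1 ((hperf q).2 ρ hn).2.1 χ
      exact ⟨x, AddMonoidHom.ext fun y => by rw [hb_apply, hx y]⟩
  -- `#A · #X = #H¹(K_q, Tw T)`
  have hcount := natCard_annihilator_mul_natCard
    (fun y => galoisCohomology.nsmul_eq_zero_of_forall ((cd.twist ρ).toLocal (Sum.inr q)) hn y) b hb
    ((𝓡.selmerGroup.map (galoisCohomology.localization ρ (Sum.inr (cd.σ • q)) 1)).map (cd.transportH1 ρ q))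
    (𝓡.selmerGroup.map (galoisCohomology.localization ρ (Sum.inr q) 1)) fun a => by
      rw [← D.forall_reading_eq_zero_iff_mem_map_localization_frob lam hlam exp hexp hn hρ inv hPT hSC hperf hΘ hdet
        S hS 𝓕 𝓡 hq hqS h𝓡S hrel hoff horth hstab hinf a]
      simp only [hb_apply]
  -- `#X = #A` and `#H¹(K_q, Tw T) = #H¹(K_q, T)`
  rw [AddSubgroup.card_map_of_injective (cd.transportH1_injective ρ q),
    natCard_map_localization_eq_of_eq ρ 𝓡.selmerGroup hq,
    ← Nat.card_eq_of_bijective _ (cd.transportH1_bijective ρ q),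
    natCard_galoisCohomology_toLocal_eq_of_eq ρ hq] at hcount
  exact hcount

end DualityDatum

end Literature.NumberTheory.GaloisCohomology.Howard2004

end
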